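import Literature.Computability.AlgebraicComplexity.TauConjectureThreeFacts
import Literature.Computability.AlgebraicComplexity.BurgisserThm210Proofs
import Literature.Computability.AlgebraicComplexity.ValiantCompleteness
import HarnessLib

/-!
# The two τ-conjecture transfer theorems from two classical named facts

Assembly update for the named fact
`Literature.Computability.AlgebraicComplexity.not_isPBounded_constantFreeComplexity_perPoly_of_tauConjecture`
(`TauConjecture.lean`; Bürgisser, Comput. Complexity 18 (2009), Main Thm. 1.2 = ECCC TR06-113
Thm. 1.1(2) = STACS 2007 Thm. 1(2): the Shub–Smale τ-conjecture implies that `τ(PER_n)` is not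
polynomially bounded) and for its real analogue
`not_isPBounded_constantFreeComplexity_perPoly_of_realTauConjecture` (Koiran 2011 / Tavenas 2014,
Thm. 3.3).

`TauConjectureThreeFacts.lean` reduced the first to three classical named facts (Cor. 3.9,
Valiant's `#P`-hardness of the `0/1` permanent, Thm. 2.10). Bürgisser's Thm. 2.10 — the
constant-free `VNP`-completeness of the permanent in `τ`-form — is now a THEOREM of the tree
(`Burgisser2009_thm210_holds`, `BurgisserThm210Proofs.lean`), and so is Valiant's algebraic
completeness theorem over `ℚ` (`isVNPComplete_perPoly_holds`, `ValiantCompleteness.lean`). Hence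
BOTH transfer theorems follow from exactly two named facts, each a classical theorem:

* `Burgisser2009_esymm_chDefinable` — Bürgisser's Cor. 3.9 (ECCC) = STACS Cor. of Thm. 14: the
  elementary symmetric functions `σ_k(1, …, n)` are definable in the counting hierarchy
  (iterated multiplication in `CH`, Hesse–Allender–Barrington arithmetic scaled up);
* `Valiant1979_per01Plain_isSharpPHardFun` — Valiant 1979, Thm. 1: the `0/1` permanent is
  `#P`-hard under polynomial-time Turing reductions.

* `not_isPBounded_constantFreeComplexity_perPoly_of_tauConjecture_of_two_facts h39 hV`;
* `not_isPBounded_constantFreeComplexity_perPoly_of_realTauConjecture_of_two_facts h39 hV`;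
* `Burgisser2009_thm41_2_uniform_of_valiant_holds hV` (Thm. 4.1(2), uniform form, from Valiant's
  theorem alone).

## References

* P. Bürgisser, Comput. Complexity 18 (2009) 81–103 = ECCC TR06-113, Main Thm. 1.2, Thm. 2.10,
  Cor. 3.9, Thm. 4.1; STACS 2007, LNCS 4393, pp. 133–144.
* L. G. Valiant, TCS 8 (1979) 189–201, Thm. 1.
* S. Tavenas, PhD thesis, ENS Lyon 2014, Thm. 3.3.
-/

namespace Literature.Computability.AlgebraicComplexity

/-- **Bürgisser's Thm. 4.1(2) (uniform form) from Valiant's theorem alone** (Thm. 2.10 and the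
Koiran step being theorems of the tree). [cite: Burgisser2006, Thm. 4.1(2)] -/
theorem Burgisser2009_thm41_2_uniform_of_valiant_holds (hV : Valiant1979_per01Plain_isSharpPHardFun) :
    Burgisser2009_thm41_2_uniform :=
  Burgisser2009_thm41_2_uniform_of_valiant_thm210 hV Burgisser2009_thm210_holds

/-- **Bürgisser's transfer theorem from two classical named facts** — Cor. 3.9 (`σ_k(1,…,n)`
definable in `CH`) and Valiant's `#P`-hardness of the `0/1` permanent: the Shub–Smale
τ-conjecture implies that `τ(PER_n)` is not polynomially bounded. [cite: Burgisser2009, Main Thm. 1.2] -/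
theorem not_isPBounded_constantFreeComplexity_perPoly_of_tauConjecture_of_two_facts
    (h39 : Burgisser2009_esymm_chDefinable) (hV : Valiant1979_per01Plain_isSharpPHardFun) :
    not_isPBounded_constantFreeComplexity_perPoly_of_tauConjecture :=
  not_isPBounded_constantFreeComplexity_perPoly_of_tauConjecture_of_three_facts h39 hV
    Burgisser2009_thm210_holds

/-- **The Koiran–Tavenas transfer theorem from two classical named facts** — Cor. 3.9 and
Valiant's `#P`-hardness of the `0/1` permanent (the `VNP`-completeness of `PER` over `ℚ` being a
theorem of the tree): the real τ-conjecture forces `τ(PER_n)` to be superpolynomial. [cite: Tavenas2014, Thm. 3.3] -/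
theorem not_isPBounded_constantFreeComplexity_perPoly_of_realTauConjecture_of_two_facts
    (h39 : Burgisser2009_esymm_chDefinable) (hV : Valiant1979_per01Plain_isSharpPHardFun) :
    not_isPBounded_constantFreeComplexity_perPoly_of_realTauConjecture :=
  not_isPBounded_constantFreeComplexity_perPoly_of_realTauConjecture_of_valiant h39
    (isVNPComplete_perPoly_holds ℚ) hV

end Literature.Computability.AlgebraicComplexity
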